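import Literature.Geometry.Hyperkaehler.ComplexStructureAdaptedBasis
import Mathlib.Topology.Algebra.Module.FiniteDimension
import HarnessLib

/-!
# `dim N_I = 4n²`: the complex structures anticommuting with a fixed one on a `4n`-dimensional real space
# (Buskin–Izadi, arXiv v2 Cor. 1.4 = v1 Cor. 1.3) — the linear algebra: `dim_ℝ gl(V) = 8n²`, `dim_ℝ gl(V, ℍ) = 4n²`,
# `T_J N_I = ad_J(gl(V)) = {X | XI = −IX, XJ = −JX}` of dimension `4n² = 8n² − 4n²`; and §1.5's
# `dim G_{I,S} = dim G_ℍ + 1 = 4n² + 1`, `dim M_I = 8n² − (4n² + 1) = 4n² − 1` (v2 Cor. 1.5 / 1.6) at the Lie-algebra level;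
# §1.7's `T_I Compl = {X | XI = −IX}` (`gl(V_ℝ) = gl(V) ⊕ T_I Compl`, dimension `8n²`, complex structure `l_I = I·`, `T_I S = ⟨J, K⟩`)

Topic `Literature/Geometry/Hyperkaehler`, namespace `Literature.Geometry.Hyperkaehler.AnticommutingOrbit`. Written by the
literature seat `lit-w-verbitsky` (gen 14) of the cell `pub-hsemireg` (HodgeConjecture venture), 2026-08-25, as a kernel leg of
row V-V13 of that cell's Verbitsky table ("[BI20] v2 Rem. 2: twistor directions through a period: real dim `4n² − 1`").
THEOREMS ONLY (no definition, no named fact, no `sorry`). Nothing in this file is a statement about the Hodge conjecture.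

## Source, verbatim (arXiv v2 = the cell's numbering of record; "v2 p.N Lm" = PDF page N, text-layer line m of
## arXiv:1806.07831v2, sha256/16 9e1097db4f2fd005; the held corpus text `paper:arxiv-1806.07831` is arXiv v1, whose §1 numbers
## are one lower: v1 Prop. 1.2 / Cor. 1.3 / Cor. 1.4 / Cor. 1.5 = v2 Prop. 1.3 / Cor. 1.4 / Cor. 1.5 / Cor. 1.6)

N. Buskin, E. Izadi, *Twistor lines in the period domain of complex tori*, arXiv:1806.07831v2 (28 Jun 2020) = Geom. Dedicata
213 (2021) 21–47 (journal pages unseen by the cell), §1 "The space of twistor spheres". Set-up, §1.1, v2 p.5 L22–24: "Let `A`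
be a complex torus of dimension `2n`. Denote by `V_ℝ` the real tangent space `T_{ℝ,0}A` and by `V` the complex tangent space
… so that `dim_ℝ V_ℝ = 2 dim_ℂ V = 4n`."; p.5 L30–31: "`Compl` is the orbit of `I` under the conjugation action of
`G := GL(V_ℝ)`: `Compl ≅ G/G_I`, where `G_I ≅ GL_{2n}(ℂ)` is the stabilizer of `I`." (v1: `G := GL⁺(V_ℝ)`, `G_I = GL(V_ℝ, I)
≅ GL(V)`; both forms are in the tree's `ComplexStructureAdaptedBasis.lean`); v2 p.6 L42–43, **Prop. 1.3**: "The group `G_I`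
acts transitively on the set `N_I` of complex structures anticommuting with `I`."

* §1.4, v2 p.6 L50–58: "Therefore, given a complex structure `J ∈ N_I`, `N_I = G_I · J ≅ G_I/G_{I,J}` is the orbit of `J`
  under `G_I`, where `G_{I,J}` is the stabilizer group of `J` in `G_I`. Since `G_{I,J}` is the subgroup of elements of
  `G_I = GL(V)` commuting with `J`, that is, preserving the quaternionic structure on `V_ℝ` determined by `I` and `J`, we
  have `G_{I,J} ≅ GL(V, ℍ)` which we will also denote by `G_ℍ`. So `N_I ≅ GL(V)/GL(V, ℍ)` and we deduce
  **Corollary 1.4.** The set `N_I` is a real submanifold of `Compl` of dimension `4n²`.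
  *Proof.* The dimension of the orbit as a complex manifold is `dim_ℂ GL(V) − dim_ℂ GL(V, ℍ) = (2n)² − 2n² = 2n²`. The real
  dimension is thus equal to `4n²`. □" (v1, corpus chunk p0006 L21–23, inserts after "`= 2n²`": "(the complex dimension of
  the space of quaternionic `n × n` matrices is `2n²`)".)
* §1.5, v2 p.6 L59–71: "Let `S = S(I, J)` for `J ∈ N_I` be a twistor sphere. Define `G_{I,S} ⊂ G_I` to be the stabilizer
  of `S` as a set, i.e., the set of elements `g` of `G_I` such that `g · S ⊂ S`. For any `g ∈ G_{I,S}`, the complex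
  structure `ᵍJ ∈ S` also anticommutes with `I`, so `ᵍJ` is of the form `aJ + bK`, `a² + b² = 1`. Setting
  `a = cos t, b = sin t` we have `aJ + bK = e^{tI/2} J e^{−tI/2}`, where `e^{sI} = cos s 1 + sin s I ∈ G_I` realizes, via the
  conjugation action, the rotations of `S` around `{±I}`. […] Explicitly, we have `G_{I,S} = ⟨e^{tI}, t ∈ ℝ⟩ × G_ℍ`, where
  `⟨e^{tI}, t ∈ ℝ⟩ ≅ S¹` (which is a subgroup of the center of `G_I`). This tells us, in particular, that
  `dim_ℝ G_{I,S} = dim_ℝ G_ℍ + 1 = 4n² + 1`."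
* v2 p.7 L3–12: "Let `M_I` be the set of all twistor spheres in `Compl` containing `I`. […] for the `S¹`-action
  `J ∈ N_I ↦ e^{tI}J` … we have `N_I/S¹ = M_I`. Therefore Corollary 1.4 immediately implies **Corollary 1.5.** The set `M_I`
  is a real manifold of dimension `4n² − 1`."; §1.6, p.7 L18–24: "Proposition 1.3 immediately implies **Corollary 1.6.** The
  group `G_I` acts transitively on `M_I ≅ G_I/G_{I,S}` so that `C_I = ⋃_{g ∈ G_I} g · S(I, J)`. We will … prove that the cone
  `C_I` is a real-analytic subset of `Compl` of dimension `4n² + 1` (Proposition 2.6)."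
* Rem. 2, v2 p.4 L30–36: "the variety of lines in `ℙ^{4n²}`, passing through a fixed point, has complex dimension `4n² − 1`
  […] thus its real dimension is `8n² − 2`. On the other hand, by Corollary 1.5, the real dimension of the space of all
  twistor lines, passing through a fixed point in the period domain, is `4n² − 1`. Thus, through a given point, there are
  “half as many” twistor lines as general rational curves".
* §1.7, v2 p.7 L31–32, **Prop. 1.7**: "The submanifold `Compl ⊂ End(V_ℝ)` is a complex manifold. Its complex structure `l_I`
  is given by left multiplication by `I` on `T_I Compl ⊂ End(V_ℝ)`."; proof, p.7 L60–p.8 L8: "We note that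
  `T_I Compl ≅ T_eG/T_eG_I` and, as `T_eG_I` consists of all operators in `End(V_ℝ)` commuting with `I`, the tangent space
  `T_I Compl` can be identified with the subspace of operators in `End(V_ℝ)` anticommuting with `I`. Indeed, every operator
  `X ∈ End(V_ℝ)` can be written as a sum of an operator anticommuting with `I` and an operator commuting with `I`,
  `X = ½(X − X^I) + ½(X + X^I)`, where `X^I = IXI⁻¹`."; p.8 L31–35, **Cor. 1.8**: "The twistor spheres `S² ⊂ Compl` are
  complex submanifolds. *Proof.* … the tangent space of `S² = S(I, J)` at the point `I`, for `I, J, K = IJ` satisfying the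
  quaternionic identities, is the 2-plane `⟨J, K⟩_ℝ ⊂ T_I Compl` and this plane is obviously invariant under left
  multiplication by `I`.".

## What is formalised (`F` = `V_ℝ`, finite-dimensional real normed space of dimension `4n`; `L, J : F →L[ℝ] F` with
## `L² = J² = −1`, `JL = −LJ` — the paper's `I` and one `J ∈ N_I`; operators `X : F →L[ℝ] F` = `gl(V_ℝ)`)

The LINEAR dimension counts behind the printed proofs and the linearisation of `N_I = G_I · J` at `J`, all basis-free in
the statements (any carrier submodule of `gl(V_ℝ)` with the stated membership condition) and proved in an adapted block
basis `(e_a, Je_a, Le_a, LJe_a)_{a < n}` of `V_ℝ` (the tree's `ComplexStructure.exists_pairAdapted_basis`,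
`ComplexStructureAdaptedBasis.lean`; Buskin–Izadi's `⟨v, Iv, Jv, IJv⟩`, §1.2):

* §2 `finrank_eq_of_signs`: for signs `ε₁, ε₂ ∈ {±1}`, `dim_ℝ {X | XL = ε₁LX, XJ = ε₂JX} = 4n²` — such an `X` is freely
  determined by the `n` vectors `Xe_a ∈ V_ℝ` (evaluation at the `e_a` is a linear isomorphism onto `V_ℝⁿ`). With
  `ε₁ = ε₂ = 1`: **`finrank_commutant_pair`**, `dim_ℝ gl(V, ℍ) = 4n²` (v1: "the complex dimension of the space of
  quaternionic `n × n` matrices is `2n²`" — the Lie algebra of the stabilizer `G_{I,J} = G_ℍ`). With `ε₁ = ε₂ = −1`: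
  **`finrank_biAnticommutant`**, `dim_ℝ {X | XL = −LX, XJ = −JX} = 4n²`.
* §3 `finrank_eq_of_sign` / **`finrank_commutant`**: `dim_ℝ {X | XL = LX} = 8n²` (`= dim_ℝ gl(V)`, "`G_I ≅ GL_{2n}(ℂ)`",
  `dim_ℂ GL(V) = (2n)²`): `X` is freely determined by the `2n` vectors `Xe_a`, `XJe_a`.
* §4 **`commutator_mem`** / **`exists_commutator_eq`** / **`mem_iff_exists_commutator`**: the LINEARISATION of
  "`N_I = G_I · J`": for `Y ∈ gl(V)` (`YL = LY`) the commutator `ad_J Y = YJ − JY` anticommutes with BOTH `L` and `J`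
  (it is tangent at `J` to `{J' | J'² = −1, J'L = −LJ'} = N_I`: differentiate `J_t² = −1`, `J_tL = −LJ_t`), and conversely
  every `X` with `XL = −LX`, `XJ = −JX` is such a commutator, `X = ad_J(−½XJ)` with `−½XJ ∈ gl(V)`; the kernel of `ad_J`
  on `gl(V)` is `gl(V, ℍ)` (`commutator_eq_zero_iff`). Hence **`finrank_biAnticommutant_eq_sub`**: `dim_ℝ T_J N_I =
  dim_ℝ gl(V) − dim_ℝ gl(V, ℍ) = 8n² − 4n² = 4n²` — the printed subtraction "`(2n)² − 2n² = 2n²` … real dimension `4n²`".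
* §5 `commutator_self_apply` (`[L, J] = 2LJ`: `L` generates the rotations of `S` about `±I`), **`finrank_sphereStabilizer`**:
  for `n ≥ 1` and any carriers `K` of `gl(V, ℍ)` and `G` of `{Y | YL = LY, [Y, J] ∈ ℝ·LJ}` (the linearisation at the
  identity of "`g ∈ G_I` such that `g · S ⊂ S`": `ᵍJ` must stay on the great circle `{aJ + bK}`, whose tangent line at `J`
  is `ℝ·K`) one has `G = K ⊕ ℝ·L`, so `dim G = dim K + 1 = 4n² + 1` ("`G_{I,S} = ⟨e^{tI}⟩ × G_ℍ` … `dim_ℝ G_{I,S} =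
  dim_ℝ G_ℍ + 1 = 4n² + 1`"); **`finrank_commutant_sub_sphereStabilizer`**: `dim gl(V) − dim G = 8n² − (4n² + 1) = 4n² − 1`,
  the number of Cor. 1.5 ("`M_I` is a real manifold of dimension `4n² − 1`") via Cor. 1.6 ("`M_I ≅ G_I/G_{I,S}`").
* §6 **`eq_antiCommutingPart_add_commutingPart`** (`X = ½(X + LXL) + ½(X − LXL)` = the printed `½(X − X^I) + ½(X + X^I)`,
  `X^I = IXI⁻¹ = −IXI`: anticommuting + commuting parts), **`isCompl_commutant_anticommutant`** (`End(V_ℝ) = gl(V) ⊕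
  {X | XL = −LX}`, any carriers), **`finrank_anticommutant`** (`dim {X | XL = −LX} = 8n²`, and `8n² + 8n² = dim End(V_ℝ)`:
  "`T_I Compl ≅ T_eG/T_eG_I`" with `dim G = 16n²`, `dim G_I = 8n²`), **`comp_mem_anticommutant`** (`X ↦ LX` preserves the
  anticommutant and squares to `−1`: Prop. 1.7's "`l_I` is given by left multiplication by `I` on `T_I Compl`"),
  **`span_J_K_invariant`** (`J`, `K = LJ` anticommute with `L` and `⟨J, K⟩_ℝ` is stable under `X ↦ LX`: Cor. 1.8's "this
  plane is obviously invariant under left multiplication by `I`").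

## What is NOT here

That `Compl`, `N_I` are submanifolds of `End(V_ℝ)` with the tangent spaces named above, that `G_{I,S}` is a Lie subgroup
with the Lie algebra above, `M_I = N_I/S¹ ≅ G_I/G_{I,S}` as manifolds (the orbit/stabilizer theorems for the Lie group `G_I`),
that `l_I` is integrable / induced from `Gr(2n, 4n)` (Prop. 1.7's first sentence and its proof via `φ ∘ l_I = iφ`), that `S²`
is a complex submanifold (Cor. 1.8's conclusion), §1.6 / Prop. 2.6's cone `C_I` (dimension `4n² + 1`), Rem. 1.9, Rem. 2's
comparison with rational curves in `ℙ^{4n²}`: differential/algebraic geometry, not linear algebra. Only the dimension counts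
of the Lie algebras / tangent spaces, the splitting of `End(V_ℝ)`, the operator `l_I` and the linearised orbit map are
formalised.

## References

* [BuskinIzadi2020TwistorLinesTori] N. Buskin, E. Izadi, *Twistor lines in the period domain of complex tori*, Geom.
  Dedicata 213 (2021) 21–47 = arXiv:1806.07831v2, §1.1–§1.7 (Prop. 1.3, Cor. 1.4, Cor. 1.5, Cor. 1.6, Prop. 1.7, Cor. 1.8),
  Rem. 2 — read on the v2 PDF text layer (pp. 4–8) and in the corpus text of v1 (`paper:arxiv-1806.07831`, chunks p0003,
  p0005–p0006).
* [Buskin2018GeneralizedTwistorLines] N. Buskin, *A generalization of twistor lines for complex tori*, arXiv:1806.08390, §3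
  ("all representations `ℍ(−1) = ℍ → End V_ℝ` are equivalent and are direct sums of the unique irreducible
  4-representations of `ℍ`" — the block basis).
-/

noncomputable section

open Module

namespace Literature.Geometry.Hyperkaehler.AnticommutingOrbit

variable {F : Type*} [NormedAddCommGroup F] [NormedSpace ℝ F]

/-! ### §1 The adapted block basis: how `L` and `J` act -/

/-- How `L` and `J` act on an adapted block basis `(e_a, Je_a, Le_a, LJe_a)_a` — `r ((β₁, β₂), a)` with `β₁` = "apply `L`",
`β₂` = "apply `J`": `L` raises `β₁` (with a sign on the way back), `J` raises `β₂` (signs from `J² = −1`, `JL = −LJ`).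
[cite: BuskinIzadi2020TwistorLinesTori, §1.2 (v2 pp.5–6: the `h`-orthonormal basis `⟨v, Iv, Jv, IJv⟩` in which `J` has canonical form)] -/
theorem pairAdapted_basis_tables {L J : F →L[ℝ] F} (hL : ∀ v, L (L v) = -v) (hJ : ∀ v, J (J v) = -v)
    (hLJ : ∀ v, J (L v) = -L (J v)) {m : ℕ} {e : Fin m → F} {r : Basis ((Bool × Bool) × Fin m) ℝ F}
    (hr : ∀ s, r s = bif s.1.1 then L (bif s.1.2 then J (e s.2) else e s.2) else (bif s.1.2 then J (e s.2) else e s.2)) :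
    (∀ a, r ((false, false), a) = e a) ∧
    (∀ β₂ a, L (r ((false, β₂), a)) = r ((true, β₂), a)) ∧ (∀ β₂ a, L (r ((true, β₂), a)) = -r ((false, β₂), a)) ∧
    (∀ a, J (r ((false, false), a)) = r ((false, true), a)) ∧ (∀ a, J (r ((false, true), a)) = -r ((false, false), a)) ∧
    (∀ a, J (r ((true, false), a)) = -r ((true, true), a)) ∧ ∀ a, J (r ((true, true), a)) = r ((true, false), a) := by
  refine ⟨fun a ↦ by simp [hr], fun β₂ a ↦ ?_, fun β₂ a ↦ ?_, fun a ↦ by simp [hr], fun a ↦ by simp [hr, hJ],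
    fun a ↦ by simp [hr, hLJ], fun a ↦ by simp [hr, hLJ, hJ]⟩
  · cases β₂ <;> simp [hr]
  · cases β₂ <;> simp [hr, hL]

variable [FiniteDimensional ℝ F]

/-! ### §2 `dim = 4n²` with two prescribed signs: `gl(V, ℍ)` and the bi-anticommutant -/

/-- **`dim_ℝ {X | XL = ε₁LX, XJ = ε₂JX} = 4n²` (`ε₁, ε₂ ∈ {±1}`).** For an anticommuting pair of complex structures `L, J`
on a real space of dimension `4n`, an operator with prescribed (anti)commutation signs against `L` and `J` is freely
determined by its values on the `n` vectors `e_a` of an adapted block basis (`X(Le_a) = ε₁LXe_a`, `X(Je_a) = ε₂JXe_a`,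
`X(LJe_a) = ε₁ε₂LJXe_a`): evaluation `X ↦ (Xe_a)_a` is a linear isomorphism onto `V_ℝⁿ`, of dimension `n · 4n`.
[cite: BuskinIzadi2020TwistorLinesTori, Cor. 1.4 and its proof (v2 §1.4, p.6 L50–58: "`(2n)² − 2n² = 2n²`. The real dimension
is thus equal to `4n²`"; = v1 Cor. 1.3, whose proof adds "(the complex dimension of the space of quaternionic `n × n` matrices
is `2n²`)" — the case `ε₁ = ε₂ = 1`)] -/
theorem finrank_eq_of_signs {n : ℕ} (hF : finrank ℝ F = 4 * n) {L J : F →L[ℝ] F} (hL : ∀ v, L (L v) = -v)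
    (hJ : ∀ v, J (J v) = -v) (hLJ : ∀ v, J (L v) = -L (J v)) {ε₁ ε₂ : ℝ} (hε₁ : ε₁ * ε₁ = 1) (hε₂ : ε₂ * ε₂ = 1)
    (C : Submodule ℝ (F →L[ℝ] F))
    (hC : ∀ X, X ∈ C ↔ (∀ v, X (L v) = ε₁ • L (X v)) ∧ ∀ v, X (J v) = ε₂ • J (X v)) :
    finrank ℝ C = 4 * n ^ 2 := by
  classical
  obtain ⟨m, e, r, hr⟩ := ComplexStructure.exists_pairAdapted_basis L J hL hJ hLJ
  have hFm : finrank ℝ F = 4 * m := by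
    rw [finrank_eq_card_basis r, Fintype.card_prod, Fintype.card_prod, Fintype.card_bool, Fintype.card_fin]
  have hm : m = n := by omega
  subst hm
  obtain ⟨hr00, hLf, hLt, hJ00, hJ01, hJ10, hJ11⟩ := pairAdapted_basis_tables hL hJ hLJ hr
  -- evaluation at the `e a` is a linear isomorphism `C ≅ V_ℝ^m`
  let ev : C →ₗ[ℝ] (Fin m → F) :=
    { toFun := fun X a ↦ (X : F →L[ℝ] F) (e a)
      map_add' := fun X Y ↦ by funext a; simp
      map_smul' := fun c X ↦ by funext a; simp }
  have hev : ∀ X : C, ∀ a, ev X a = (X : F →L[ℝ] F) (e a) := fun X a ↦ rfl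
  -- injective: an `X ∈ C` vanishing on the `e a` vanishes on the whole block basis
  have hinj : Function.Injective ev := by
    refine (injective_iff_map_eq_zero ev).2 fun X hX ↦ ?_
    have hXa : ∀ a, (X : F →L[ℝ] F) (r ((false, false), a)) = 0 := fun a ↦ by
      rw [hr00, ← hev, hX]; rfl
    obtain ⟨hXL, hXJ⟩ := (hC X).1 X.2
    have h0 : ((X : F →L[ℝ] F) : F →ₗ[ℝ] F) = 0 := by
      refine r.ext fun s ↦ ?_
      rcases s with ⟨⟨β₁, β₂⟩, a⟩
      have h1 : (X : F →L[ℝ] F) (r ((false, true), a)) = 0 := by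
        rw [← hJ00, hXJ, hXa, map_zero, smul_zero]
      cases β₁ <;> cases β₂
      · simpa using hXa a
      · simpa using h1
      · simp only [ContinuousLinearMap.coe_coe, LinearMap.zero_apply, ← hLf, hXL, hXa, map_zero, smul_zero]
      · simp only [ContinuousLinearMap.coe_coe, LinearMap.zero_apply, ← hLf, hXL, h1, map_zero, smul_zero]
    exact Subtype.ext (ContinuousLinearMap.coe_injective (h0.trans ContinuousLinearMap.toLinearMap_zero.symm))
  -- surjective: extend `e a ↦ w a` by the prescribed signs
  have hsurj : Function.Surjective ev := by
    intro w
    let f : (Bool × Bool) × Fin m → F := fun s ↦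
      bif s.1.1 then (bif s.1.2 then (ε₁ * ε₂) • L (J (w s.2)) else ε₁ • L (w s.2))
      else (bif s.1.2 then ε₂ • J (w s.2) else w s.2)
    let X₀ : F →ₗ[ℝ] F := r.constr ℝ f
    have hX₀ : ∀ β₁ β₂ a, X₀ (r ((β₁, β₂), a)) =
        (bif β₁ then (bif β₂ then (ε₁ * ε₂) • L (J (w a)) else ε₁ • L (w a))
          else (bif β₂ then ε₂ • J (w a) else w a)) := fun β₁ β₂ a ↦ by
      simp [X₀, f]
    have h122 : ε₁ * ε₂ * ε₂ = ε₁ := by rw [mul_assoc, hε₂, mul_one]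
    have hXL : X₀ ∘ₗ (L : F →ₗ[ℝ] F) = ε₁ • ((L : F →ₗ[ℝ] F) ∘ₗ X₀) := by
      refine r.ext fun s ↦ ?_
      rcases s with ⟨⟨β₁, β₂⟩, a⟩
      cases β₁ <;> cases β₂ <;> simp [hLf, hLt, hX₀, hL, smul_smul, ← mul_assoc, hε₁]
    have hXJ : X₀ ∘ₗ (J : F →ₗ[ℝ] F) = ε₂ • ((J : F →ₗ[ℝ] F) ∘ₗ X₀) := by
      refine r.ext fun s ↦ ?_
      rcases s with ⟨⟨β₁, β₂⟩, a⟩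
      cases β₁ <;> cases β₂ <;>
        simp [hJ00, hJ01, hJ10, hJ11, hX₀, hJ, hLJ, smul_smul, ← mul_assoc, hε₂, mul_comm ε₂ ε₁, h122]
    have hmem : LinearMap.toContinuousLinearMap X₀ ∈ C := by
      refine (hC _).2 ⟨fun v ↦ ?_, fun v ↦ ?_⟩
      · simpa using LinearMap.congr_fun hXL v
      · simpa using LinearMap.congr_fun hXJ v
    refine ⟨⟨_, hmem⟩, funext fun a ↦ ?_⟩
    rw [hev]
    change X₀ (e a) = w a
    rw [← hr00, hX₀]
    rfl
  rw [(LinearEquiv.ofBijective ev ⟨hinj, hsurj⟩).finrank_eq, Module.finrank_pi_fintype, Finset.sum_const,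
    Finset.card_univ, Fintype.card_fin, hF, smul_eq_mul]
  ring

/-- **`dim_ℝ gl(V, ℍ) = 4n²`**: the operators commuting with both `L` and `J` — the Lie algebra of the stabilizer
`G_{I,J} = GL(V, ℍ) = G_ℍ` of `J` in `G_I` — form a real vector space of dimension `4n²` (v1: "the complex dimension of the
space of quaternionic `n × n` matrices is `2n²`"). [cite: BuskinIzadi2020TwistorLinesTori, v2 §1.4, p.6 L50–58 (proof of Cor. 1.4;
= v1 §1.3 Cor. 1.3, corpus chunk p0006 L12–25)] -/
theorem finrank_commutant_pair {n : ℕ} (hF : finrank ℝ F = 4 * n) {L J : F →L[ℝ] F} (hL : ∀ v, L (L v) = -v)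
    (hJ : ∀ v, J (J v) = -v) (hLJ : ∀ v, J (L v) = -L (J v)) (K : Submodule ℝ (F →L[ℝ] F))
    (hK : ∀ X, X ∈ K ↔ (∀ v, X (L v) = L (X v)) ∧ ∀ v, X (J v) = J (X v)) : finrank ℝ K = 4 * n ^ 2 :=
  finrank_eq_of_signs hF hL hJ hLJ (ε₁ := 1) (ε₂ := 1) (by norm_num) (by norm_num) K fun X ↦ by
    simpa only [one_smul] using hK X

/-- **`dim_ℝ {X | XL = −LX, XJ = −JX} = 4n²`**: the operators anticommuting with both `L` and `J` (the tangent space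
`T_J N_I`, see `mem_iff_exists_commutator`) form a real vector space of dimension `4n²` — Cor. 1.4's number "`dim N_I = 4n²`".
[cite: BuskinIzadi2020TwistorLinesTori, Cor. 1.4 (v2 p.6 L55: "The set `N_I` is a real submanifold of `Compl` of dimension
`4n²`."; = v1 Cor. 1.3)] -/
theorem finrank_biAnticommutant {n : ℕ} (hF : finrank ℝ F = 4 * n) {L J : F →L[ℝ] F} (hL : ∀ v, L (L v) = -v)
    (hJ : ∀ v, J (J v) = -v) (hLJ : ∀ v, J (L v) = -L (J v)) (A : Submodule ℝ (F →L[ℝ] F))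
    (hA : ∀ X, X ∈ A ↔ (∀ v, X (L v) = -L (X v)) ∧ ∀ v, X (J v) = -J (X v)) : finrank ℝ A = 4 * n ^ 2 :=
  finrank_eq_of_signs hF hL hJ hLJ (ε₁ := -1) (ε₂ := -1) (by norm_num) (by norm_num) A fun X ↦ by
    simpa only [neg_one_smul] using hA X

/-! ### §3 `dim_ℝ gl(V) = 8n²` -/

/-- **`dim_ℝ {X | XL = ε₁LX} = 8n²` (`ε₁ ∈ {±1}`)**: an operator with one prescribed sign against `L` is freely determined by
its values on the `2n` vectors `e_a`, `Je_a` of an adapted block basis (`X(Le_a) = ε₁LXe_a`, `X(LJe_a) = ε₁LXJe_a`), so the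
space is `≅ V_ℝ^{2n}`, of dimension `2n · 4n`. [cite: BuskinIzadi2020TwistorLinesTori, §1.1 (v2 p.5 L31: "`G_I ≅ GL_{2n}(ℂ)` is
the stabilizer of `I`") and the proof of Cor. 1.4 (v2 p.6 L56–57: "`dim_ℂ GL(V) − dim_ℂ GL(V, ℍ) = (2n)² − 2n²`")] -/
theorem finrank_eq_of_sign {n : ℕ} (hF : finrank ℝ F = 4 * n) {L J : F →L[ℝ] F} (hL : ∀ v, L (L v) = -v)
    (hJ : ∀ v, J (J v) = -v) (hLJ : ∀ v, J (L v) = -L (J v)) {ε₁ : ℝ} (hε₁ : ε₁ * ε₁ = 1)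
    (C : Submodule ℝ (F →L[ℝ] F)) (hC : ∀ X, X ∈ C ↔ ∀ v, X (L v) = ε₁ • L (X v)) :
    finrank ℝ C = 8 * n ^ 2 := by
  classical
  obtain ⟨m, e, r, hr⟩ := ComplexStructure.exists_pairAdapted_basis L J hL hJ hLJ
  have hFm : finrank ℝ F = 4 * m := by
    rw [finrank_eq_card_basis r, Fintype.card_prod, Fintype.card_prod, Fintype.card_bool, Fintype.card_fin]
  have hm : m = n := by omega
  subst hm
  obtain ⟨-, hLf, hLt, -, -, -, -⟩ := pairAdapted_basis_tables hL hJ hLJ hr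
  -- evaluation at the `e a` and the `J e a` (the `β₁ = false` half of the basis)
  let ev : C →ₗ[ℝ] (Bool × Fin m → F) :=
    { toFun := fun X s ↦ (X : F →L[ℝ] F) (r ((false, s.1), s.2))
      map_add' := fun X Y ↦ by funext s; simp
      map_smul' := fun c X ↦ by funext s; simp }
  have hev : ∀ X : C, ∀ s, ev X s = (X : F →L[ℝ] F) (r ((false, s.1), s.2)) := fun X s ↦ rfl
  have hinj : Function.Injective ev := by
    refine (injective_iff_map_eq_zero ev).2 fun X hX ↦ ?_
    have hXa : ∀ β₂ a, (X : F →L[ℝ] F) (r ((false, β₂), a)) = 0 := fun β₂ a ↦ by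
      rw [← hev X (β₂, a), hX]; rfl
    have hXL := (hC X).1 X.2
    have h0 : ((X : F →L[ℝ] F) : F →ₗ[ℝ] F) = 0 := by
      refine r.ext fun s ↦ ?_
      rcases s with ⟨⟨β₁, β₂⟩, a⟩
      cases β₁
      · simpa using hXa β₂ a
      · simp only [ContinuousLinearMap.coe_coe, LinearMap.zero_apply, ← hLf, hXL, hXa, map_zero, smul_zero]
    exact Subtype.ext (ContinuousLinearMap.coe_injective (h0.trans ContinuousLinearMap.toLinearMap_zero.symm))
  have hsurj : Function.Surjective ev := by
    intro w
    let f : (Bool × Bool) × Fin m → F := fun s ↦ bif s.1.1 then ε₁ • L (w (s.1.2, s.2)) else w (s.1.2, s.2)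
    let X₀ : F →ₗ[ℝ] F := r.constr ℝ f
    have hX₀ : ∀ β₁ β₂ a, X₀ (r ((β₁, β₂), a)) = (bif β₁ then ε₁ • L (w (β₂, a)) else w (β₂, a)) :=
      fun β₁ β₂ a ↦ by simp [X₀, f]
    have hXL : X₀ ∘ₗ (L : F →ₗ[ℝ] F) = ε₁ • ((L : F →ₗ[ℝ] F) ∘ₗ X₀) := by
      refine r.ext fun s ↦ ?_
      rcases s with ⟨⟨β₁, β₂⟩, a⟩
      cases β₁ <;> simp [hLf, hLt, hX₀, hL, smul_smul, hε₁]
    have hmem : LinearMap.toContinuousLinearMap X₀ ∈ C := by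
      refine (hC _).2 fun v ↦ ?_
      simpa using LinearMap.congr_fun hXL v
    refine ⟨⟨_, hmem⟩, funext fun s ↦ ?_⟩
    rw [hev]
    change X₀ (r ((false, s.1), s.2)) = w s
    rw [hX₀]
    rfl
  rw [(LinearEquiv.ofBijective ev ⟨hinj, hsurj⟩).finrank_eq, Module.finrank_pi_fintype, Finset.sum_const,
    Finset.card_univ, Fintype.card_prod, Fintype.card_bool, Fintype.card_fin, hF, smul_eq_mul]
  ring

/-- **`dim_ℝ gl(V) = 8n²`**: the operators commuting with `L` — the Lie algebra of `G_I ≅ GL(V)`, `V = (V_ℝ, I)` of complex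
dimension `2n` — form a real vector space of dimension `8n² = 2·(2n)²`. [cite: BuskinIzadi2020TwistorLinesTori, §1.1 (v2 p.5
L31: "`G_I ≅ GL_{2n}(ℂ)`"; v2 p.6 L44–45: "`G_I ≅ GL(V) < GL⁺(V_ℝ) = GL⁺_{4n}(ℝ)`") and the proof of Cor. 1.4 (v2 p.6 L56–57)] -/
theorem finrank_commutant {n : ℕ} (hF : finrank ℝ F = 4 * n) {L J : F →L[ℝ] F} (hL : ∀ v, L (L v) = -v)
    (hJ : ∀ v, J (J v) = -v) (hLJ : ∀ v, J (L v) = -L (J v)) (C : Submodule ℝ (F →L[ℝ] F))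
    (hC : ∀ X, X ∈ C ↔ ∀ v, X (L v) = L (X v)) : finrank ℝ C = 8 * n ^ 2 :=
  finrank_eq_of_sign hF hL hJ hLJ (ε₁ := 1) (by norm_num) C fun X ↦ by simpa only [one_smul] using hC X

/-! ### §4 The linearised orbit map `ad_J : gl(V) → T_J N_I` and `dim N_I = dim GL(V) − dim GL(V, ℍ)` -/

omit [FiniteDimensional ℝ F] in
/-- **`ad_J` maps `gl(V)` into the bi-anticommutant.** If `Y` commutes with `L`, then the commutator `X = YJ − JY`
anticommutes with `L` and with `J` (`J² = −1`, `JL = −LJ`) — the infinitesimal form of "`N_I = G_I · J`": the orbit map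
`g ↦ gJg⁻¹` of `G_I` linearises at the identity to `Y ↦ [Y, J]`, with values tangent to `N_I = {J' | J'² = −1, J'L = −LJ'}`.
[cite: BuskinIzadi2020TwistorLinesTori, v2 §1.4 (p.6 L50–51: "`N_I = G_I · J ≅ G_I/G_{I,J}` is the orbit of `J` under `G_I`")] -/
theorem commutator_mem {L J Y : F →L[ℝ] F} (hJ : ∀ v, J (J v) = -v) (hLJ : ∀ v, J (L v) = -L (J v))
    (hY : ∀ v, Y (L v) = L (Y v)) :
    (∀ v, (Y.comp J - J.comp Y) (L v) = -L ((Y.comp J - J.comp Y) v)) ∧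
      ∀ v, (Y.comp J - J.comp Y) (J v) = -J ((Y.comp J - J.comp Y) v) := by
  refine ⟨fun v ↦ ?_, fun v ↦ ?_⟩
  · simp only [_root_.sub_apply, ContinuousLinearMap.coe_comp, Function.comp_apply, hLJ, map_neg, hY, map_sub]
    abel
  · simp only [_root_.sub_apply, ContinuousLinearMap.coe_comp, Function.comp_apply, hJ, map_sub, map_neg]
    abel

omit [FiniteDimensional ℝ F] in
/-- **Every bi-anticommuting `X` is a commutator `[Y, J]` with `Y ∈ gl(V)`**: for `XL = −LX`, `XJ = −JX` the operator
`Y = −½·XJ` commutes with `L` and satisfies `YJ − JY = X` (as `JXJ = X`). So `ad_J : gl(V) → {X | XL = −LX, XJ = −JX}` is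
ONTO: the linearised orbit map of `N_I = G_I · J` at `J` fills the whole bi-anticommutant.
[cite: BuskinIzadi2020TwistorLinesTori, v2 §1.4 (p.6 L50–54) with Cor. 1.4 (p.6 L55–58)] -/
theorem exists_commutator_eq {L J X : F →L[ℝ] F} (hJ : ∀ v, J (J v) = -v) (hLJ : ∀ v, J (L v) = -L (J v))
    (hXL : ∀ v, X (L v) = -L (X v)) (hXJ : ∀ v, X (J v) = -J (X v)) :
    ∃ Y : F →L[ℝ] F, (∀ v, Y (L v) = L (Y v)) ∧ Y.comp J - J.comp Y = X := by
  refine ⟨(-(1 / 2 : ℝ)) • X.comp J, fun v ↦ ?_, ?_⟩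
  · simp only [_root_.smul_apply, ContinuousLinearMap.coe_comp, Function.comp_apply, hLJ, map_neg, hXL, neg_neg,
      map_smul]
  · ext v
    simp only [_root_.sub_apply, _root_.smul_apply, ContinuousLinearMap.coe_comp, Function.comp_apply, hJ, map_neg,
      map_smul, hXJ, neg_neg, smul_neg]
    module

omit [FiniteDimensional ℝ F] in
/-- The kernel of `ad_J` on `gl(V)` is `gl(V, ℍ)`: `YJ − JY = 0` iff `Y` commutes with `J` — the Lie algebra of the
stabilizer "`G_{I,J}` is the subgroup of elements of `G_I = GL(V)` commuting with `J`".
[cite: BuskinIzadi2020TwistorLinesTori, v2 §1.4 (p.6 L51–53)] -/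
theorem commutator_eq_zero_iff {J Y : F →L[ℝ] F} : Y.comp J - J.comp Y = 0 ↔ ∀ v, Y (J v) = J (Y v) := by
  rw [ContinuousLinearMap.ext_iff]
  simp [sub_eq_zero]

omit [FiniteDimensional ℝ F] in
/-- **`T_J N_I = ad_J(gl(V))`, linearised "`N_I = G_I · J ≅ G_I / G_{I,J}`".** For any carriers `C` of `gl(V) = {Y | YL = LY}`
and `A` of the bi-anticommutant `{X | XL = −LX, XJ = −JX}`: `X ∈ A` iff `X = YJ − JY` for some `Y ∈ C`.
[cite: BuskinIzadi2020TwistorLinesTori, v2 §1.4 (p.6 L50–54) with Cor. 1.4 (p.6 L55–58)] -/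
theorem mem_iff_exists_commutator {L J : F →L[ℝ] F} (hJ : ∀ v, J (J v) = -v) (hLJ : ∀ v, J (L v) = -L (J v))
    (C : Submodule ℝ (F →L[ℝ] F)) (hC : ∀ Y, Y ∈ C ↔ ∀ v, Y (L v) = L (Y v)) (A : Submodule ℝ (F →L[ℝ] F))
    (hA : ∀ X, X ∈ A ↔ (∀ v, X (L v) = -L (X v)) ∧ ∀ v, X (J v) = -J (X v)) (X : F →L[ℝ] F) :
    X ∈ A ↔ ∃ Y ∈ C, Y.comp J - J.comp Y = X := by
  constructor
  · intro hX
    obtain ⟨hXL, hXJ⟩ := (hA X).1 hX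
    obtain ⟨Y, hY, hYX⟩ := exists_commutator_eq hJ hLJ hXL hXJ
    exact ⟨Y, (hC Y).2 hY, hYX⟩
  · rintro ⟨Y, hY, rfl⟩
    exact (hA _).2 (commutator_mem hJ hLJ ((hC Y).1 hY))

/-- **Cor. 1.4 as printed: `dim N_I = dim GL(V) − dim GL(V, ℍ)`, "`(2n)² − 2n² = 2n²` … real dimension `4n²`".** On a real
space of dimension `4n` with an anticommuting pair `L, J`: `dim_ℝ {X | XL = −LX, XJ = −JX}` (`= T_J N_I`,
`mem_iff_exists_commutator`) `= dim_ℝ gl(V) − dim_ℝ gl(V, ℍ) = 8n² − 4n² = 4n²`. [cite: BuskinIzadi2020TwistorLinesTori, Cor. 1.4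
and its proof (v2 §1.4, p.6 L55–58; = v1 Cor. 1.3)] -/
theorem finrank_biAnticommutant_eq_sub {n : ℕ} (hF : finrank ℝ F = 4 * n) {L J : F →L[ℝ] F} (hL : ∀ v, L (L v) = -v)
    (hJ : ∀ v, J (J v) = -v) (hLJ : ∀ v, J (L v) = -L (J v)) (C : Submodule ℝ (F →L[ℝ] F))
    (hC : ∀ Y, Y ∈ C ↔ ∀ v, Y (L v) = L (Y v)) (K : Submodule ℝ (F →L[ℝ] F))
    (hK : ∀ Y, Y ∈ K ↔ (∀ v, Y (L v) = L (Y v)) ∧ ∀ v, Y (J v) = J (Y v)) (A : Submodule ℝ (F →L[ℝ] F))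
    (hA : ∀ X, X ∈ A ↔ (∀ v, X (L v) = -L (X v)) ∧ ∀ v, X (J v) = -J (X v)) :
    finrank ℝ C = 8 * n ^ 2 ∧ finrank ℝ K = 4 * n ^ 2 ∧ finrank ℝ A = 4 * n ^ 2 ∧
      finrank ℝ A = finrank ℝ C - finrank ℝ K := by
  refine ⟨finrank_commutant hF hL hJ hLJ C hC, finrank_commutant_pair hF hL hJ hLJ K hK,
    finrank_biAnticommutant hF hL hJ hLJ A hA, ?_⟩
  rw [finrank_commutant hF hL hJ hLJ C hC, finrank_commutant_pair hF hL hJ hLJ K hK,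
    finrank_biAnticommutant hF hL hJ hLJ A hA]
  exact Nat.eq_sub_of_add_eq (by ring)

/-! ### §5 The stabilizer of the sphere: `dim G_{I,S} = dim G_ℍ + 1 = 4n² + 1`, and `dim M_I = dim G_I − dim G_{I,S} = 4n² − 1` -/

omit [FiniteDimensional ℝ F] in
/-- `[L, J] = 2LJ` (`= 2K`): the generator `L` (`= I`) of the rotations `e^{tI}` of the sphere `S(I, J)` about `±I` moves
`J` in the direction `K`. [cite: BuskinIzadi2020TwistorLinesTori, v2 §1.5 (p.6 L62–68: "`aJ + bK = e^{tI/2} J e^{−tI/2}`, where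
`e^{sI} = cos s 1 + sin s I ∈ G_I` realizes, via the conjugation action, the rotations of `S` around `{±I}`"; v1: "via the
adjoint action")] -/
theorem commutator_self_apply {L J : F →L[ℝ] F} (hLJ : ∀ v, J (L v) = -L (J v)) (v : F) :
    L (J v) - J (L v) = (2 : ℝ) • L (J v) := by
  rw [hLJ, two_smul, sub_neg_eq_add]

/-- **`dim_ℝ Lie(G_{I,S}) = dim_ℝ gl(V, ℍ) + 1 = 4n² + 1`.** For `n ≥ 1`, an anticommuting pair `L, J` on a `4n`-dimensional
real space, and any carriers `K` of `gl(V, ℍ) = {Y | YL = LY, YJ = JY}` and `G` of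
`{Y | YL = LY, [Y, J] ∈ ℝ·LJ}` — the linearisation at the identity of the stabilizer "`G_{I,S} ⊂ G_I` … the set of elements
`g` of `G_I` such that `g · S ⊂ S`" (for `g ∈ G_I`, `gJg⁻¹` anticommutes with `I`, so `g · S ⊂ S` iff `gJg⁻¹` lies on the
great circle `{aJ + bK}`, whose tangent line at `J` is `ℝ·K`): `G = K ⊕ ℝ·L` (`[L, J] = 2LJ`, so `Y − (c/2)L ∈ K` when
`[Y, J] = c·LJ`; `L ∉ K`), hence `dim G = 4n² + 1` — "Explicitly, we have `G_{I,S} = ⟨e^{tI}, t ∈ ℝ⟩ × G_ℍ` … This tells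
us, in particular, that `dim_ℝ G_{I,S} = dim_ℝ G_ℍ + 1 = 4n² + 1`." [cite: BuskinIzadi2020TwistorLinesTori, v2 §1.5 (p.6 L59–71; =
v1 §1.4, corpus chunk p0006 L30–42)] -/
theorem finrank_sphereStabilizer {n : ℕ} (hn : 0 < n) (hF : finrank ℝ F = 4 * n) {L J : F →L[ℝ] F}
    (hL : ∀ v, L (L v) = -v) (hJ : ∀ v, J (J v) = -v) (hLJ : ∀ v, J (L v) = -L (J v)) (K : Submodule ℝ (F →L[ℝ] F))
    (hK : ∀ Y, Y ∈ K ↔ (∀ v, Y (L v) = L (Y v)) ∧ ∀ v, Y (J v) = J (Y v)) (G : Submodule ℝ (F →L[ℝ] F))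
    (hG : ∀ Y, Y ∈ G ↔ (∀ v, Y (L v) = L (Y v)) ∧ ∃ c : ℝ, ∀ v, Y (J v) - J (Y v) = c • L (J v)) :
    finrank ℝ G = finrank ℝ K + 1 ∧ finrank ℝ G = 4 * n ^ 2 + 1 := by
  -- `V_ℝ ≠ 0`, so `LJ ≠ 0` (indeed `(LJ)² = −1`) and `L ∉ gl(V, ℍ)`
  have hF0 : Nontrivial F := Module.nontrivial_of_finrank_pos (R := ℝ) (by omega : 0 < finrank ℝ F)
  obtain ⟨v₀, hv₀⟩ := exists_ne (0 : F)
  have hLJLJ : ∀ v, L (J (L (J v))) = -v := fun v ↦ by rw [hLJ, map_neg, hL, hJ, neg_neg]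
  have hLJv₀ : L (J v₀) ≠ 0 := fun h ↦ by
    have h1 := hLJLJ v₀
    rw [h, map_zero, map_zero] at h1
    exact hv₀ (neg_eq_zero.mp h1.symm)
  have hL0 : L ≠ 0 := by
    rintro rfl
    exact hLJv₀ rfl
  have hLK : L ∉ K := fun h ↦ by
    have h2 := ((hK L).1 h).2 v₀
    rw [hLJ, eq_neg_iff_add_eq_zero, ← two_smul ℝ] at h2
    exact hLJv₀ (by simpa using h2)
  have hLG : L ∈ G := (hG L).2 ⟨fun v ↦ rfl, 2, fun v ↦ commutator_self_apply hLJ v⟩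
  have hKG : K ≤ G := fun Y hY ↦
    (hG Y).2 ⟨((hK Y).1 hY).1, 0, fun v ↦ by rw [((hK Y).1 hY).2, sub_self, zero_smul]⟩
  -- `G = K ⊔ ℝ·L`
  have hsup : K ⊔ (ℝ ∙ L) = G := by
    refine le_antisymm (sup_le hKG ((Submodule.span_singleton_le_iff_mem _ _).2 hLG)) fun Y hY ↦ ?_
    obtain ⟨hYL, c, hc⟩ := (hG Y).1 hY
    have hY' : Y - (c / 2) • L ∈ K := by
      refine (hK _).2 ⟨fun v ↦ ?_, fun v ↦ ?_⟩
      · simp only [_root_.sub_apply, _root_.smul_apply, hYL, hL, map_sub, map_smul]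
      · have hcv := hc v
        rw [sub_eq_iff_eq_add] at hcv
        simp only [_root_.sub_apply, _root_.smul_apply, hcv, hLJ, map_sub, map_smul, smul_neg]
        module
    have hY : Y = (Y - (c / 2) • L) + (c / 2) • L := by abel
    rw [hY]
    exact Submodule.add_mem_sup hY' (Submodule.smul_mem _ _ (Submodule.mem_span_singleton_self L))
  -- `K ⊓ ℝ·L = 0`
  have hinf : K ⊓ (ℝ ∙ L) = ⊥ := by
    rw [Submodule.eq_bot_iff]
    rintro Y ⟨hYK, hYL⟩
    obtain ⟨a, rfl⟩ := Submodule.mem_span_singleton.1 hYL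
    rcases eq_or_ne a 0 with rfl | ha
    · rw [zero_smul]
    · exfalso
      apply hLK
      have h := K.smul_mem a⁻¹ hYK
      rwa [smul_smul, inv_mul_cancel₀ ha, one_smul] at h
  have h1 : finrank ℝ (ℝ ∙ L) = 1 := finrank_span_singleton hL0
  have hdim := Submodule.finrank_sup_add_finrank_inf_eq K (ℝ ∙ L)
  rw [hsup, hinf, finrank_bot, add_zero, h1] at hdim
  exact ⟨hdim, by rw [hdim, finrank_commutant_pair hF hL hJ hLJ K hK]⟩

/-- **Cor. 1.5 / Cor. 1.6's number: `dim M_I = dim G_I − dim G_{I,S} = 8n² − (4n² + 1) = 4n² − 1`** ("The set `M_I` [of twistor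
spheres through `I`] is a real manifold of dimension `4n² − 1`"; "The group `G_I` acts transitively on `M_I ≅ G_I/G_{I,S}`") —
at the level of the Lie algebras: `dim_ℝ gl(V) − dim_ℝ Lie(G_{I,S}) = 4n² − 1` (`n ≥ 1`).
[cite: BuskinIzadi2020TwistorLinesTori, Cor. 1.5 (v2 p.7 L3–12; = v1 Cor. 1.4) and Cor. 1.6 (v2 §1.6, p.7 L18–21; = v1 Cor. 1.5);
Rem. 2 (v2 p.4 L33–36)] -/
theorem finrank_commutant_sub_sphereStabilizer {n : ℕ} (hn : 0 < n) (hF : finrank ℝ F = 4 * n) {L J : F →L[ℝ] F}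
    (hL : ∀ v, L (L v) = -v) (hJ : ∀ v, J (J v) = -v) (hLJ : ∀ v, J (L v) = -L (J v)) (C : Submodule ℝ (F →L[ℝ] F))
    (hC : ∀ Y, Y ∈ C ↔ ∀ v, Y (L v) = L (Y v)) (K : Submodule ℝ (F →L[ℝ] F))
    (hK : ∀ Y, Y ∈ K ↔ (∀ v, Y (L v) = L (Y v)) ∧ ∀ v, Y (J v) = J (Y v)) (G : Submodule ℝ (F →L[ℝ] F))
    (hG : ∀ Y, Y ∈ G ↔ (∀ v, Y (L v) = L (Y v)) ∧ ∃ c : ℝ, ∀ v, Y (J v) - J (Y v) = c • L (J v)) :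
    finrank ℝ C - finrank ℝ G = 4 * n ^ 2 - 1 := by
  rw [finrank_commutant hF hL hJ hLJ C hC, (finrank_sphereStabilizer hn hF hL hJ hLJ K hK G hG).2]
  omega

/-! ### §6 `T_I Compl = {X | XI = −IX}`: the decomposition `gl(V_ℝ) = gl(V) ⊕ T_I Compl`, `dim = 8n²`, the complex structure `l_I`, and `T_I S(I,J) = ⟨J, K⟩` -/

omit [FiniteDimensional ℝ F] in
/-- **`X = ½(X − X^I) + ½(X + X^I)`, `X^I = IXI⁻¹`.** For a complex structure `L` (`L⁻¹ = −L`, so `X^L = −LXL`) every operator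
is the sum of `½(X + LXL)`, which ANTIcommutes with `L`, and `½(X − LXL)`, which commutes with `L`.
[cite: BuskinIzadi2020TwistorLinesTori, v2 §1.7, proof of Prop. 1.7 (p.8 L4–8: "every operator `X ∈ End(V_ℝ)` can be written as
a sum of an operator anticommuting with `I` and an operator commuting with `I`, `X = ½(X − X^I) + ½(X + X^I)`, where
`X^I = IXI⁻¹`")] -/
theorem eq_antiCommutingPart_add_commutingPart {L : F →L[ℝ] F} (hL : ∀ v, L (L v) = -v) (X : F →L[ℝ] F) :
    X = (1 / 2 : ℝ) • (X + L.comp (X.comp L)) + (1 / 2 : ℝ) • (X - L.comp (X.comp L)) ∧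
      (∀ v, ((1 / 2 : ℝ) • (X + L.comp (X.comp L))) (L v) = -L (((1 / 2 : ℝ) • (X + L.comp (X.comp L))) v)) ∧
      ∀ v, ((1 / 2 : ℝ) • (X - L.comp (X.comp L))) (L v) = L (((1 / 2 : ℝ) • (X - L.comp (X.comp L))) v) := by
  refine ⟨?_, fun v ↦ ?_, fun v ↦ ?_⟩
  · ext v
    simp only [_root_.add_apply, _root_.smul_apply, _root_.sub_apply]
    module
  · simp only [_root_.smul_apply, _root_.add_apply, ContinuousLinearMap.coe_comp, Function.comp_apply, hL, map_add,
      map_neg, map_smul, smul_add, smul_neg, neg_add_rev]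
    module
  · simp only [_root_.smul_apply, _root_.sub_apply, ContinuousLinearMap.coe_comp, Function.comp_apply, hL, map_sub,
      map_neg, map_smul, smul_sub]
    module

omit [FiniteDimensional ℝ F] in
/-- **`gl(V_ℝ) = gl(V) ⊕ T_I Compl`**: for any carriers `C` of the commutant `{X | XL = LX}` (`= T_eG_I`) and `T` of the
anticommutant `{X | XL = −LX}` (`≅ T_eG/T_eG_I = T_I Compl`), `C` and `T` are complementary subspaces of `End(V_ℝ)` (an
operator commuting and anticommuting with `L` is `0`, and every operator splits as in
`eq_antiCommutingPart_add_commutingPart`). [cite: BuskinIzadi2020TwistorLinesTori, v2 §1.7 (p.7 L60–p.8 L8: "`T_I Compl ≅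
T_eG/T_eG_I` and, as `T_eG_I` consists of all operators in `End(V_ℝ)` commuting with `I`, the tangent space `T_I Compl` can be
identified with the subspace of operators in `End(V_ℝ)` anticommuting with `I`")] -/
theorem isCompl_commutant_anticommutant {L : F →L[ℝ] F} (hL : ∀ v, L (L v) = -v) (C : Submodule ℝ (F →L[ℝ] F))
    (hC : ∀ X, X ∈ C ↔ ∀ v, X (L v) = L (X v)) (T : Submodule ℝ (F →L[ℝ] F))
    (hT : ∀ X, X ∈ T ↔ ∀ v, X (L v) = -L (X v)) : IsCompl C T := by
  refine IsCompl.of_eq ?_ ?_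
  · rw [Submodule.eq_bot_iff]
    rintro X ⟨hXC, hXT⟩
    have hc := (hC X).1 hXC
    have ht := (hT X).1 hXT
    ext v
    -- `L (X v) = X (L v) = −L (X v)`, so `L (X v) = 0`, so `X v = −L (L (X v)) = 0`
    have h1 : L (X v) = 0 := by
      have h := (hc v).symm.trans (ht v)
      rw [eq_neg_iff_add_eq_zero, ← two_smul ℝ] at h
      simpa using h
    have h2 : X v = 0 := by
      have h3 := hL (X v)
      rw [h1, map_zero] at h3
      exact neg_eq_zero.mp h3.symm
    simp [h2]
  · rw [Submodule.eq_top_iff']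
    intro X
    obtain ⟨hX, ha, hc⟩ := eq_antiCommutingPart_add_commutingPart hL X
    rw [hX, add_comm]
    exact Submodule.add_mem_sup ((hC _).2 hc) ((hT _).2 ha)

/-- **`dim_ℝ T_I Compl = dim_ℝ {X | XL = −LX} = 8n²`** on a `4n`-dimensional `V_ℝ` — half of `dim End(V_ℝ) = 16n²`, the
other half being `gl(V)` (`finrank_commutant`): "`Compl ≅ G/G_I`" with `G = GL(V_ℝ)` of dimension `(4n)²` and `G_I ≅ GL_{2n}(ℂ)`
of real dimension `8n²`. (The case `ε₁ = −1` of `finrank_eq_of_sign`; `J` enters only to supply the block basis.)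
[cite: BuskinIzadi2020TwistorLinesTori, v2 §1.1 (p.5 L30–31: "`Compl ≅ G/G_I`, where `G_I ≅ GL_{2n}(ℂ)` is the stabilizer of
`I`") and §1.7 (p.7 L60–p.8 L3)] -/
theorem finrank_anticommutant {n : ℕ} (hF : finrank ℝ F = 4 * n) {L J : F →L[ℝ] F} (hL : ∀ v, L (L v) = -v)
    (hJ : ∀ v, J (J v) = -v) (hLJ : ∀ v, J (L v) = -L (J v)) (T : Submodule ℝ (F →L[ℝ] F))
    (hT : ∀ X, X ∈ T ↔ ∀ v, X (L v) = -L (X v)) :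
    finrank ℝ T = 8 * n ^ 2 ∧ finrank ℝ T + finrank ℝ T = finrank ℝ (F →L[ℝ] F) := by
  have h8 : finrank ℝ T = 8 * n ^ 2 :=
    finrank_eq_of_sign hF hL hJ hLJ (ε₁ := -1) (by norm_num) T fun X ↦ by simpa only [neg_one_smul] using hT X
  refine ⟨h8, ?_⟩
  have hE : finrank ℝ (F →L[ℝ] F) = finrank ℝ F * finrank ℝ F := by
    rw [← Module.finrank_linearMap ℝ ℝ F F, LinearEquiv.finrank_eq LinearMap.toContinuousLinearMap.symm]
  rw [h8, hE, hF]
  ring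

omit [FiniteDimensional ℝ F] in
/-- **The complex structure `l_I` of `Compl` at `I` is left multiplication by `I`**: `X ↦ LX` maps the anticommutant
`{X | XL = −LX}` to itself and squares to `−1` there. [cite: BuskinIzadi2020TwistorLinesTori, Prop. 1.7 (v2 p.7 L31–32: "Its
complex structure `l_I` is given by left multiplication by `I` on `T_I Compl ⊂ End(V_ℝ)`")] -/
theorem comp_mem_anticommutant {L : F →L[ℝ] F} (hL : ∀ v, L (L v) = -v) (T : Submodule ℝ (F →L[ℝ] F))
    (hT : ∀ X, X ∈ T ↔ ∀ v, X (L v) = -L (X v)) {X : F →L[ℝ] F} (hX : X ∈ T) :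
    L.comp X ∈ T ∧ L.comp (L.comp X) = -X := by
  have h := (hT X).1 hX
  refine ⟨(hT _).2 fun v ↦ ?_, ?_⟩
  · simp only [ContinuousLinearMap.coe_comp, Function.comp_apply, h, map_neg]
  · ext v
    simp only [ContinuousLinearMap.coe_comp, Function.comp_apply, hL, _root_.neg_apply]

omit [FiniteDimensional ℝ F] in
/-- **`T_I S(I, J) = ⟨J, K⟩_ℝ ⊂ T_I Compl` is `l_I`-invariant** (Cor. 1.8's observation): `J` and `K = LJ` anticommute with `L`,
and left multiplication by `L` maps `J ↦ K`, `K ↦ −J`, so the real plane they span inside the anticommutant is stable under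
`l_I` — "this plane is obviously invariant under left multiplication by `I`". [cite: BuskinIzadi2020TwistorLinesTori, Cor. 1.8
and its proof (v2 p.8 L31–35: "the tangent space of `S² = S(I, J)` at the point `I` … is the 2-plane `⟨J, K⟩_ℝ ⊂ T_I Compl`
and this plane is obviously invariant under left multiplication by `I`")] -/
theorem span_J_K_invariant {L J : F →L[ℝ] F} (hL : ∀ v, L (L v) = -v) (hLJ : ∀ v, J (L v) = -L (J v))
    (T : Submodule ℝ (F →L[ℝ] F)) (hT : ∀ X, X ∈ T ↔ ∀ v, X (L v) = -L (X v)) :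
    J ∈ T ∧ L.comp J ∈ T ∧ Submodule.span ℝ {J, L.comp J} ≤ T ∧
      ∀ X ∈ Submodule.span ℝ {J, L.comp J}, L.comp X ∈ Submodule.span ℝ {J, L.comp J} := by
  have hJT : J ∈ T := (hT J).2 hLJ
  have hKT : L.comp J ∈ T := (comp_mem_anticommutant hL T hT hJT).1
  have hLK : L.comp (L.comp J) = -J := (comp_mem_anticommutant hL T hT hJT).2
  refine ⟨hJT, hKT, Submodule.span_le.2 ?_, fun X hX ↦ ?_⟩
  · rintro X (rfl | rfl)
    · exact hJT
    · exact hKT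
  · rw [Submodule.mem_span_pair] at hX ⊢
    obtain ⟨a, b, rfl⟩ := hX
    refine ⟨-b, a, ?_⟩
    rw [ContinuousLinearMap.comp_add, ContinuousLinearMap.comp_smul, ContinuousLinearMap.comp_smul, hLK]
    module

end Literature.Geometry.Hyperkaehler.AnticommutingOrbit
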